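import Mathlib
import Summits.AnomalousDissipation.AnomalousDissipation.Theorems.DyadicWallCascadeDyadicRealisationLerayCappingTools
import Summits.AnomalousDissipation.AnomalousDissipation.Theorems.DyadicWallCascadeDyadicRealisationLerayCappingTools5
import Summits.AnomalousDissipation.AnomalousDissipation.Theorems.DyadicWallCascadeDyadicRealisationLerayCappingTools6
import HarnessLib

/-!
# Leray capping, tools VII: the residual force of the capped pair

Tools file for `stub_lerayCapping` (crux `DyadicRealisation`, line Sketch).  For the lid `(U, P)`
of tools VI the **residual** `R₀ = (U·∇)U + ∇P` on the layer `0 < Y₂ < 1`, extended by `0` to the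
collar `{Y₂ < 1/16} ∪ {Y₂ > 15/16}`, is a smooth horizontally periodic field on all of `ℝ³`: on the
collar the lid coincides with the hierarchy `(V, Q)` resp. with its mirror image, both exact steady
Euler flows, so the two definitions agree on the overlap (`lerayCapping_residual`).  The capped
pair and its residual are packaged in `lerayCapping_capped_pair`.  Ends with the registered stub
`stub_lerayCappingTools7`.
-/

open Set Function MeasureTheory Filter Topology
open scoped BigOperators ContDiff

set_option linter.dupNamespace false

namespace Summit.AnomalousDissipation.AnomalousDissipation.Theorems

/-- **The residual force.** See the module docstring. [folklore] -/
theorem lerayCapping_residual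
    (V : EuclideanSpace ℝ (Fin 3) → EuclideanSpace ℝ (Fin 3)) (Q : EuclideanSpace ℝ (Fin 3) → ℝ)
    (U : EuclideanSpace ℝ (Fin 3) → EuclideanSpace ℝ (Fin 3)) (P : EuclideanSpace ℝ (Fin 3) → ℝ)
    (hV : ContDiffOn ℝ ((⊤ : ℕ∞) : WithTop ℕ∞) V {X : EuclideanSpace ℝ (Fin 3) | 0 < X 2})
    (hQ : ContDiffOn ℝ ((⊤ : ℕ∞) : WithTop ℕ∞) Q {X : EuclideanSpace ℝ (Fin 3) | 0 < X 2})
    (hdiv : ∀ X : EuclideanSpace ℝ (Fin 3), 0 < X 2 →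
      ∑ i : Fin 3, (fderiv ℝ V X (EuclideanSpace.single i (1 : ℝ))) i = 0)
    (hE : ∀ X : EuclideanSpace ℝ (Fin 3), 0 < X 2 → (fderiv ℝ V X) (V X) + gradient Q X = 0)
    (hU : ContDiffOn ℝ ((⊤ : ℕ∞) : WithTop ℕ∞) U {Y : EuclideanSpace ℝ (Fin 3) | 0 < Y 2 ∧ Y 2 < 1})
    (hP : ContDiffOn ℝ ((⊤ : ℕ∞) : WithTop ℕ∞) P {Y : EuclideanSpace ℝ (Fin 3) | 0 < Y 2 ∧ Y 2 < 1})
    (hper : ∀ Y : EuclideanSpace ℝ (Fin 3),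
      U (Y + EuclideanSpace.single 0 (1 : ℝ)) = U Y ∧ U (Y + EuclideanSpace.single 1 (1 : ℝ)) = U Y ∧
      P (Y + EuclideanSpace.single 0 (1 : ℝ)) = P Y ∧ P (Y + EuclideanSpace.single 1 (1 : ℝ)) = P Y)
    (hlow : ∀ Y : EuclideanSpace ℝ (Fin 3), 0 < Y 2 → Y 2 < 5 / 64 → U Y = V Y ∧ P Y = Q Y)
    (hup : ∀ Y : EuclideanSpace ℝ (Fin 3), 59 / 64 < Y 2 → Y 2 < 1 →
      U Y = V (Y + (1 - 2 * Y 2) • EuclideanSpace.single 2 (1 : ℝ)) -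
          (2 * (V (Y + (1 - 2 * Y 2) • EuclideanSpace.single 2 (1 : ℝ))) 2) •
            EuclideanSpace.single 2 (1 : ℝ) ∧
        P Y = Q (Y + (1 - 2 * Y 2) • EuclideanSpace.single 2 (1 : ℝ))) :
    ∃ R₀ : EuclideanSpace ℝ (Fin 3) → EuclideanSpace ℝ (Fin 3),
      ContDiff ℝ ((⊤ : ℕ∞) : WithTop ℕ∞) R₀ ∧
      (∀ Y : EuclideanSpace ℝ (Fin 3),
        R₀ (Y + EuclideanSpace.single 0 (1 : ℝ)) = R₀ Y ∧ R₀ (Y + EuclideanSpace.single 1 (1 : ℝ)) = R₀ Y) ∧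
      (∀ Y : EuclideanSpace ℝ (Fin 3), (Y 2 < 1 / 16 ∨ 15 / 16 < Y 2) → R₀ Y = 0) ∧
      (∀ Y : EuclideanSpace ℝ (Fin 3), 0 < Y 2 → Y 2 < 1 →
        R₀ Y = fderiv ℝ U Y (U Y) + gradient P Y) := by
  set S : Set (EuclideanSpace ℝ (Fin 3)) := {Y | 0 < Y 2 ∧ Y 2 < 1} with hS
  have hc2c : Continuous fun Y : EuclideanSpace ℝ (Fin 3) => Y 2 := PiLp.continuous_apply 2 _ 2
  have hopen : IsOpen {X : EuclideanSpace ℝ (Fin 3) | 0 < X 2} := isOpen_lt continuous_const hc2c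
  have hSo : IsOpen S := hopen.inter (isOpen_lt hc2c continuous_const)
  obtain ⟨-, -, -, hEuler'⟩ := lerayCapping_mirror_euler V Q hV hQ hdiv hE
  -- the residual
  set R₀ : EuclideanSpace ℝ (Fin 3) → EuclideanSpace ℝ (Fin 3) := fun Y =>
    if Y 2 < 1 / 16 ∨ 15 / 16 < Y 2 then 0 else fderiv ℝ U Y (U Y) + gradient P Y with hR₀
  -- the Euler identity on the two collar layers
  have hcollar : ∀ Y ∈ S, (Y 2 < 1 / 16 ∨ 15 / 16 < Y 2) → fderiv ℝ U Y (U Y) + gradient P Y = 0 := by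
    intro Y hY hc
    rcases hc with hc | hc
    · -- lower layer: `(U, P) = (V, Q)` near `Y`
      set N : Set (EuclideanSpace ℝ (Fin 3)) := {Z | 0 < Z 2 ∧ Z 2 < 5 / 64} with hN
      have hNo : IsOpen N := hopen.inter (isOpen_lt hc2c continuous_const)
      have hYN : Y ∈ N := ⟨hY.1, by show Y 2 < 5 / 64; linarith⟩
      have hU' : U =ᶠ[𝓝 Y] V := Filter.eventuallyEq_of_mem (hNo.mem_nhds hYN) fun Z hZ => (hlow Z hZ.1 hZ.2).1
      have hP' : P =ᶠ[𝓝 Y] Q := Filter.eventuallyEq_of_mem (hNo.mem_nhds hYN) fun Z hZ => (hlow Z hZ.1 hZ.2).2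
      have hg : gradient P Y = gradient Q Y := by
        show (InnerProductSpace.toDual ℝ _).symm (fderiv ℝ P Y) = (InnerProductSpace.toDual ℝ _).symm (fderiv ℝ Q Y)
        rw [hP'.fderiv_eq]
      rw [hU'.fderiv_eq, (hlow Y hY.1 (by linarith)).1, hg]
      exact hE Y hY.1
    · -- upper layer: `(U, P)` is the mirrored pair near `Y`
      set N : Set (EuclideanSpace ℝ (Fin 3)) := {Z | 59 / 64 < Z 2 ∧ Z 2 < 1} with hN
      have hNo : IsOpen N := (isOpen_lt continuous_const hc2c).inter (isOpen_lt hc2c continuous_const)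
      have hYN : Y ∈ N := ⟨by show 59 / 64 < Y 2; linarith, hY.2⟩
      have hU' : U =ᶠ[𝓝 Y] fun Y => V (Y + (1 - 2 * Y 2) • EuclideanSpace.single 2 (1 : ℝ)) -
          (2 * (V (Y + (1 - 2 * Y 2) • EuclideanSpace.single 2 (1 : ℝ))) 2) • EuclideanSpace.single 2 (1 : ℝ) :=
        Filter.eventuallyEq_of_mem (hNo.mem_nhds hYN) fun Z hZ => (hup Z hZ.1 hZ.2).1
      have hP' : P =ᶠ[𝓝 Y] fun Y => Q (Y + (1 - 2 * Y 2) • EuclideanSpace.single 2 (1 : ℝ)) :=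
        Filter.eventuallyEq_of_mem (hNo.mem_nhds hYN) fun Z hZ => (hup Z hZ.1 hZ.2).2
      have hg : gradient P Y =
          gradient (fun Y => Q (Y + (1 - 2 * Y 2) • EuclideanSpace.single 2 (1 : ℝ))) Y := by
        show (InnerProductSpace.toDual ℝ _).symm (fderiv ℝ P Y) = (InnerProductSpace.toDual ℝ _).symm _
        rw [hP'.fderiv_eq]
      rw [hU'.fderiv_eq, (hup Y (by linarith) hY.2).1, hg]
      exact hEuler' Y hY.2
  have hformula : ∀ Y ∈ S, R₀ Y = fderiv ℝ U Y (U Y) + gradient P Y := by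
    intro Y hY
    by_cases hc : Y 2 < 1 / 16 ∨ 15 / 16 < Y 2
    · simp only [hR₀, if_pos hc]; exact (hcollar Y hY hc).symm
    · simp only [hR₀, if_neg hc]
  refine ⟨R₀, ?_, fun Y => ?_, fun Y hY => by simp only [hR₀, if_pos hY], fun Y hY0 hY1 => hformula Y ⟨hY0, hY1⟩⟩
  · -- smoothness
    refine lerayCapping_contDiff_of_zero_cover R₀ S {Z | Z 2 < 1 / 16 ∨ 15 / 16 < Z 2} hSo
      ((isOpen_lt hc2c continuous_const).union (isOpen_lt continuous_const hc2c)) (fun Y => ?_) ?_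
      (fun Y hY => by simp only [hR₀, if_pos (show Y 2 < 1 / 16 ∨ 15 / 16 < Y 2 from hY)])
    · by_cases h0 : 0 < Y 2
      · by_cases h1 : Y 2 < 1
        · exact Or.inl ⟨h0, h1⟩
        · exact Or.inr (Or.inr (by linarith [not_lt.1 h1]))
      · exact Or.inr (Or.inl (by linarith [not_lt.1 h0]))
    · have hDU : ContDiffOn ℝ ∞ (fun Y => fderiv ℝ U Y (U Y)) S :=
        (hU.fderiv_of_isOpen hSo le_rfl).clm_apply hU
      have hDP : ContDiffOn ℝ ∞ (gradient P) S := by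
        show ContDiffOn ℝ ∞ (fun Y => (InnerProductSpace.toDual ℝ (EuclideanSpace ℝ (Fin 3))).symm
          (fderiv ℝ P Y)) S
        exact (InnerProductSpace.toDual ℝ (EuclideanSpace ℝ (Fin 3))).symm.contDiff.comp_contDiffOn
          (hP.fderiv_of_isOpen hSo le_rfl)
      exact (hDU.add hDP).congr hformula
  · -- periodicity
    have key : ∀ (j : Fin 3), (j = 0 ∨ j = 1) → R₀ (Y + EuclideanSpace.single j (1 : ℝ)) = R₀ Y := by
      intro j hj
      have hYj : (Y + EuclideanSpace.single j (1 : ℝ)) 2 = Y 2 := by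
        rcases hj with rfl | rfl <;> simp
      have hUf : (fun Z => U (Z + EuclideanSpace.single j (1 : ℝ))) = U := by
        funext Z; rcases hj with rfl | rfl
        · exact (hper Z).1
        · exact (hper Z).2.1
      have hPf : (fun Z => P (Z + EuclideanSpace.single j (1 : ℝ))) = P := by
        funext Z; rcases hj with rfl | rfl
        · exact (hper Z).2.2.1
        · exact (hper Z).2.2.2
      have hDU : fderiv ℝ U (Y + EuclideanSpace.single j (1 : ℝ)) = fderiv ℝ U Y := by
        rw [← fderiv_comp_add_right, hUf]
      have hDP : gradient P (Y + EuclideanSpace.single j (1 : ℝ)) = gradient P Y := by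
        show (InnerProductSpace.toDual ℝ _).symm _ = (InnerProductSpace.toDual ℝ _).symm _
        rw [← fderiv_comp_add_right, hPf]
      have hUY : U (Y + EuclideanSpace.single j (1 : ℝ)) = U Y := congrFun hUf Y
      simp only [hR₀, hYj, hDU, hDP, hUY]
    exact ⟨key 0 (Or.inl rfl), key 1 (Or.inr rfl)⟩

/-- **The capped pair.** The lid `(U, P)` of tools VI together with its residual force `R₀` of
`lerayCapping_residual`: smooth and divergence free on the layer, horizontally periodic, equal to
the hierarchy resp. its mirror image on the collar layers, bounded on the closed unit cube; `R₀`
smooth on `ℝ³`, horizontally periodic, `= (U·∇)U + ∇P` on the layer and `= 0` on the collar.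
[folklore] -/
theorem lerayCapping_capped_pair
    (V : EuclideanSpace ℝ (Fin 3) → EuclideanSpace ℝ (Fin 3)) (Q : EuclideanSpace ℝ (Fin 3) → ℝ) (C : ℝ)
    (hV : ContDiffOn ℝ ((⊤ : ℕ∞) : WithTop ℕ∞) V {X : EuclideanSpace ℝ (Fin 3) | 0 < X 2})
    (hQ : ContDiffOn ℝ ((⊤ : ℕ∞) : WithTop ℕ∞) Q {X : EuclideanSpace ℝ (Fin 3) | 0 < X 2})
    (hbd : ∀ X : EuclideanSpace ℝ (Fin 3), 0 < X 2 → ‖V X‖ ≤ C ∧ |Q X| ≤ C)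
    (hdiv : ∀ X : EuclideanSpace ℝ (Fin 3), 0 < X 2 →
      ∑ i : Fin 3, (fderiv ℝ V X (EuclideanSpace.single i (1 : ℝ))) i = 0)
    (hE : ∀ X : EuclideanSpace ℝ (Fin 3), 0 < X 2 → (fderiv ℝ V X) (V X) + gradient Q X = 0)
    (hdil : ∀ X : EuclideanSpace ℝ (Fin 3), 0 < X 2 → V ((2 : ℝ) • X) = V X ∧ Q ((2 : ℝ) • X) = Q X)
    (hper : ∀ X : EuclideanSpace ℝ (Fin 3), 1 ≤ X 2 → X 2 ≤ 2 →
      V (X + EuclideanSpace.single 0 (1 : ℝ)) = V X ∧ V (X + EuclideanSpace.single 1 (1 : ℝ)) = V X ∧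
      Q (X + EuclideanSpace.single 0 (1 : ℝ)) = Q X ∧ Q (X + EuclideanSpace.single 1 (1 : ℝ)) = Q X)
    (hmass : ∫ q in Icc (0 : ℝ) 1 ×ˢ Icc (0 : ℝ) 1, (V !₂[q.1, q.2, (1 : ℝ)]) 2 = 0) :
    ∃ (U : EuclideanSpace ℝ (Fin 3) → EuclideanSpace ℝ (Fin 3)) (P : EuclideanSpace ℝ (Fin 3) → ℝ)
      (R₀ : EuclideanSpace ℝ (Fin 3) → EuclideanSpace ℝ (Fin 3)) (M : ℝ),
      ContDiffOn ℝ ((⊤ : ℕ∞) : WithTop ℕ∞) U {Y : EuclideanSpace ℝ (Fin 3) | 0 < Y 2 ∧ Y 2 < 1} ∧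
      ContDiffOn ℝ ((⊤ : ℕ∞) : WithTop ℕ∞) P {Y : EuclideanSpace ℝ (Fin 3) | 0 < Y 2 ∧ Y 2 < 1} ∧
      (∀ Y : EuclideanSpace ℝ (Fin 3),
        U (Y + EuclideanSpace.single 0 (1 : ℝ)) = U Y ∧ U (Y + EuclideanSpace.single 1 (1 : ℝ)) = U Y ∧
        P (Y + EuclideanSpace.single 0 (1 : ℝ)) = P Y ∧ P (Y + EuclideanSpace.single 1 (1 : ℝ)) = P Y) ∧
      (∀ Y : EuclideanSpace ℝ (Fin 3), 0 < Y 2 → Y 2 < 1 →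
        ∑ i : Fin 3, (fderiv ℝ U Y (EuclideanSpace.single i (1 : ℝ))) i = 0) ∧
      (∀ Y : EuclideanSpace ℝ (Fin 3), 0 < Y 2 → Y 2 < 5 / 64 → U Y = V Y ∧ P Y = Q Y) ∧
      (∀ Y : EuclideanSpace ℝ (Fin 3), 59 / 64 < Y 2 → Y 2 < 1 →
        U Y = V (Y + (1 - 2 * Y 2) • EuclideanSpace.single 2 (1 : ℝ)) -
            (2 * (V (Y + (1 - 2 * Y 2) • EuclideanSpace.single 2 (1 : ℝ))) 2) •
              EuclideanSpace.single 2 (1 : ℝ) ∧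
          P Y = Q (Y + (1 - 2 * Y 2) • EuclideanSpace.single 2 (1 : ℝ))) ∧
      (∀ Y : EuclideanSpace ℝ (Fin 3), (∀ i, 0 ≤ Y i ∧ Y i ≤ 1) → ‖U Y‖ ≤ M) ∧
      ContDiff ℝ ((⊤ : ℕ∞) : WithTop ℕ∞) R₀ ∧
      (∀ Y : EuclideanSpace ℝ (Fin 3),
        R₀ (Y + EuclideanSpace.single 0 (1 : ℝ)) = R₀ Y ∧ R₀ (Y + EuclideanSpace.single 1 (1 : ℝ)) = R₀ Y) ∧
      (∀ Y : EuclideanSpace ℝ (Fin 3), (Y 2 < 1 / 16 ∨ 15 / 16 < Y 2) → R₀ Y = 0) ∧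
      (∀ Y : EuclideanSpace ℝ (Fin 3), 0 < Y 2 → Y 2 < 1 →
        R₀ Y = fderiv ℝ U Y (U Y) + gradient P Y) := by
  obtain ⟨U, P, hU, hP, hperUP, hdivU, hlow, hup, M, hM⟩ :=
    lerayCapping_lid V Q C hV hQ hbd hdiv hE hdil hper hmass
  obtain ⟨R₀, hR, hRper, hRz, hRf⟩ := lerayCapping_residual V Q U P hV hQ hdiv hE hU hP hperUP hlow hup
  exact ⟨U, P, R₀, M, hU, hP, hperUP, hdivU, hlow, hup, hM, hR, hRper, hRz, hRf⟩

/-- Registered tools stub of `stub_lerayCapping` (line Sketch of crux `DyadicRealisation`): the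
conjunction of the lemmas of this file. [folklore] -/
theorem stub_lerayCappingTools7 :
    ∀ (V : EuclideanSpace ℝ (Fin 3) → EuclideanSpace ℝ (Fin 3)) (Q : EuclideanSpace ℝ (Fin 3) → ℝ) (C : ℝ),
      ContDiffOn ℝ ((⊤ : ℕ∞) : WithTop ℕ∞) V {X : EuclideanSpace ℝ (Fin 3) | 0 < X 2} →
      ContDiffOn ℝ ((⊤ : ℕ∞) : WithTop ℕ∞) Q {X : EuclideanSpace ℝ (Fin 3) | 0 < X 2} →
      (∀ X : EuclideanSpace ℝ (Fin 3), 0 < X 2 → ‖V X‖ ≤ C ∧ |Q X| ≤ C) →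
      (∀ X : EuclideanSpace ℝ (Fin 3), 0 < X 2 → ∑ i : Fin 3, (fderiv ℝ V X (EuclideanSpace.single i (1 : ℝ))) i = 0) →
      (∀ X : EuclideanSpace ℝ (Fin 3), 0 < X 2 → (fderiv ℝ V X) (V X) + gradient Q X = 0) →
      (∀ X : EuclideanSpace ℝ (Fin 3), 0 < X 2 → V ((2 : ℝ) • X) = V X ∧ Q ((2 : ℝ) • X) = Q X) →
      (∀ X : EuclideanSpace ℝ (Fin 3), 1 ≤ X 2 → X 2 ≤ 2 →
        V (X + EuclideanSpace.single 0 (1 : ℝ)) = V X ∧ V (X + EuclideanSpace.single 1 (1 : ℝ)) = V X ∧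
        Q (X + EuclideanSpace.single 0 (1 : ℝ)) = Q X ∧ Q (X + EuclideanSpace.single 1 (1 : ℝ)) = Q X) →
      (∫ q in Set.Icc (0 : ℝ) 1 ×ˢ Set.Icc (0 : ℝ) 1, (V !₂[q.1, q.2, (1 : ℝ)]) 2 = 0) →
      ∃ (U : EuclideanSpace ℝ (Fin 3) → EuclideanSpace ℝ (Fin 3)) (P : EuclideanSpace ℝ (Fin 3) → ℝ) (R₀ : EuclideanSpace ℝ (Fin 3) → EuclideanSpace ℝ (Fin 3)) (M : ℝ),
        ContDiffOn ℝ ((⊤ : ℕ∞) : WithTop ℕ∞) U {Y : EuclideanSpace ℝ (Fin 3) | 0 < Y 2 ∧ Y 2 < 1} ∧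
        ContDiffOn ℝ ((⊤ : ℕ∞) : WithTop ℕ∞) P {Y : EuclideanSpace ℝ (Fin 3) | 0 < Y 2 ∧ Y 2 < 1} ∧
        (∀ Y : EuclideanSpace ℝ (Fin 3),
          U (Y + EuclideanSpace.single 0 (1 : ℝ)) = U Y ∧ U (Y + EuclideanSpace.single 1 (1 : ℝ)) = U Y ∧
          P (Y + EuclideanSpace.single 0 (1 : ℝ)) = P Y ∧ P (Y + EuclideanSpace.single 1 (1 : ℝ)) = P Y) ∧
        (∀ Y : EuclideanSpace ℝ (Fin 3), 0 < Y 2 → Y 2 < 1 → ∑ i : Fin 3, (fderiv ℝ U Y (EuclideanSpace.single i (1 : ℝ))) i = 0) ∧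
        (∀ Y : EuclideanSpace ℝ (Fin 3), 0 < Y 2 → Y 2 < 5 / 64 → U Y = V Y ∧ P Y = Q Y) ∧
        (∀ Y : EuclideanSpace ℝ (Fin 3), 59 / 64 < Y 2 → Y 2 < 1 →
          U Y = V (Y + (1 - 2 * Y 2) • EuclideanSpace.single 2 (1 : ℝ)) -
              (2 * (V (Y + (1 - 2 * Y 2) • EuclideanSpace.single 2 (1 : ℝ))) 2) •
                EuclideanSpace.single 2 (1 : ℝ) ∧
            P Y = Q (Y + (1 - 2 * Y 2) • EuclideanSpace.single 2 (1 : ℝ))) ∧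
        (∀ Y : EuclideanSpace ℝ (Fin 3), (∀ i, 0 ≤ Y i ∧ Y i ≤ 1) → ‖U Y‖ ≤ M) ∧
        ContDiff ℝ ((⊤ : ℕ∞) : WithTop ℕ∞) R₀ ∧
        (∀ Y : EuclideanSpace ℝ (Fin 3),
          R₀ (Y + EuclideanSpace.single 0 (1 : ℝ)) = R₀ Y ∧ R₀ (Y + EuclideanSpace.single 1 (1 : ℝ)) = R₀ Y) ∧
        (∀ Y : EuclideanSpace ℝ (Fin 3), (Y 2 < 1 / 16 ∨ 15 / 16 < Y 2) → R₀ Y = 0) ∧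
        (∀ Y : EuclideanSpace ℝ (Fin 3), 0 < Y 2 → Y 2 < 1 → R₀ Y = fderiv ℝ U Y (U Y) + gradient P Y) :=
  lerayCapping_capped_pair

end Summit.AnomalousDissipation.AnomalousDissipation.Theorems
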